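import Summits.Parity.GeneralizedHardyLittlewood.Theorems.BeyondDiagonalBeatsQuarter.CornerAbel
import HarnessLib

/-!
# Route `PrimeLevelFamEdge`, crux K_A `MomentsBeyondDiagonal` (stmt-Parity-20007), line «petersson_layers» v4, stub `stub_diag`:
# **the monomial bookkeeping of the order-`(1,1)` remainder weight** (remainder estimate (R), abstract form)

Third brick of the remainder estimate (R) (hypothesis `hR` of `…DiagDecorOrderOneOneAssembly.orderOneOne_target_of_remainder`,
p826053). For fixed Selberg coordinates `(c,g)` the Hecke-summed remainder weight of order `(1,1)` is
`Wt(k₁,k₂) = (L²/4 − (P₂(k₁)+P₂(k₂))/4)·r₀₀(y) + (L/2)(r₀₁(y)+r₁₀(y)) + r₁₁(y)`, `y = αk₁k₂`, `L = 2β + ℓ⁺(k₁) + ℓ⁺(k₂)`.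
This file does the purely algebraic part with ABSTRACT remainders `R₀₀, R₀₁, R₁₀, R₁₁ : ℝ → ℝ` and an abstract decoration
`P2 : ℕ → ℝ`: given the per-monomial Abel bounds
`|Σ a(k₁)a₂(k₂)ℓ⁺(k₁)ⁱℓ⁺(k₂)ʲR(αk₁k₂)| ≤ logⁱ⁺ʲY·Ψ` (`a₂ ∈ {a, a·P2}`, `i, j ≥ 1`), the profile-weighted sum
`Σ a(k₁)P(ℓ⁺₁/L)·a(k₂)P(ℓ⁺₂/L)·Wt(k₁,k₂)` is `≤ 15·(Σ|Pᵢ|)²·Λ²·Ψ` (`|β|, log Y ≤ Λ`, `1 ≤ Λ`, `log Y ≤ L`).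

* `profile_expand` — expansion of the two profile factors `P(ℓ⁺/L) = Σᵢ Pᵢℓ⁺ⁱ/Lⁱ` against any kernel;
* `coef_term_le` — `|c·βᵖ·S| ≤ Λ²·L^m·Ψ` from `|S| ≤ L^{m+d}Ψ`, `p + d ≤ 2`, `|c| ≤ 1`;
* `abs_monomial_weight_le` — one monomial `ℓ⁺(k₁)^{m₁}ℓ⁺(k₂)^{m₂}` (`m₁, m₂ ≥ 1`) against `Wt`: `≤ 15Λ²·log^{m₁+m₂}Y·Ψ`;
* `abs_profile_weight_le` — **the profile-weighted sum against `Wt`: `≤ 15(Σ|Pᵢ|)²Λ²Ψ`.**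

Def-free; theorems only. Helper `--supports stmt-Parity-20007`; closes nothing; K_A, K_B and the Parity summit are NOT
proved; nothing about Landau–Siegel zeros.

## References
* E. Kowalski, P. Michel, J. VanderKam, J. reine angew. Math. 526 (2000), (22)–(28) pp. 12–15 and Prop. 5.1 p. 18.
  [cite: KowalskiMichelVanderKam2000, (23)–(28) — derivation (order-(1,1) remainder weight, monomial bookkeeping)]
-/

noncomputable section

open Finset Real Polynomial

namespace Summit.Parity.GeneralizedHardyLittlewood.Theorems.MomentsBeyondDiagonal.DiagCorner

open Summit.Parity.GeneralizedHardyLittlewood.Theorems.BeyondDiagonalBeatsQuarter.Corner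

/-- Expansion of the two profile factors `P(ℓ⁺(k)/L) = Σᵢ Pᵢ ℓ⁺(k)ⁱ/Lⁱ` against an arbitrary kernel `G`. [folklore] -/
theorem profile_expand (P : ℝ[X]) (L Y : ℝ) (a₁ a₂ : ℕ → ℝ) (G : ℕ → ℕ → ℝ) (I : Finset ℕ) :
    ∑ k₁ ∈ I, ∑ k₂ ∈ I, a₁ k₁ * P.eval (ellp Y k₁ / L) * (a₂ k₂ * P.eval (ellp Y k₂ / L)) * G k₁ k₂ =
      ∑ i ∈ Finset.range (P.natDegree + 1), ∑ j ∈ Finset.range (P.natDegree + 1),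
        P.coeff i / L ^ i * (P.coeff j / L ^ j) *
          ∑ k₁ ∈ I, ∑ k₂ ∈ I, a₁ k₁ * a₂ k₂ * ellp Y k₁ ^ i * ellp Y k₂ ^ j * G k₁ k₂ := by
  set R := Finset.range (P.natDegree + 1) with hR
  have hexp : ∀ k₁ k₂ : ℕ, a₁ k₁ * P.eval (ellp Y k₁ / L) * (a₂ k₂ * P.eval (ellp Y k₂ / L)) * G k₁ k₂ =
      ∑ i ∈ R, ∑ j ∈ R, P.coeff i / L ^ i * (P.coeff j / L ^ j) *
        (a₁ k₁ * a₂ k₂ * ellp Y k₁ ^ i * ellp Y k₂ ^ j * G k₁ k₂) := by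
    intro k₁ k₂
    rw [Polynomial.eval_eq_sum_range, Polynomial.eval_eq_sum_range]
    simp only [← hR, div_pow]
    rw [show ∀ a e : ℝ, ∀ s t : ℝ, a * s * (e * t) * G k₁ k₂ = a * e * G k₁ k₂ * (s * t) from
      fun a e s t ↦ by ring, Finset.sum_mul_sum, Finset.mul_sum]
    refine Finset.sum_congr rfl fun i _ ↦ ?_
    rw [Finset.mul_sum]
    refine Finset.sum_congr rfl fun j _ ↦ ?_
    ring
  rw [Finset.sum_congr rfl fun k₁ _ ↦ Finset.sum_congr rfl fun k₂ _ ↦ hexp k₁ k₂]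
  rw [Finset.sum_congr rfl fun k₁ _ ↦ Finset.sum_comm, Finset.sum_comm]
  refine Finset.sum_congr rfl fun i _ ↦ ?_
  rw [Finset.sum_congr rfl fun k₁ _ ↦ Finset.sum_comm, Finset.sum_comm]
  refine Finset.sum_congr rfl fun j _ ↦ ?_
  rw [Finset.mul_sum]
  refine Finset.sum_congr rfl fun k₁ _ ↦ ?_
  rw [Finset.mul_sum]

/-- `|c·βᵖ·S| ≤ Λ²·(L^m·Ψ)` from `|S| ≤ L^n·Ψ`, `n = m + d`, `p + d ≤ 2`, `|c| ≤ 1`, `|β| ≤ Λ`, `0 ≤ L ≤ Λ`, `1 ≤ Λ`.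
[folklore] -/
theorem coef_term_le {β Λ L Ψ S c : ℝ} {p d m n : ℕ} (hΛ : 1 ≤ Λ) (hβ : |β| ≤ Λ) (hL0 : 0 ≤ L) (hL : L ≤ Λ)
    (hΨ : 0 ≤ Ψ) (hn : n = m + d) (hpd : p + d ≤ 2) (hc : |c| ≤ 1) (hS : |S| ≤ L ^ n * Ψ) :
    |c * β ^ p * S| ≤ Λ ^ 2 * (L ^ m * Ψ) := by
  subst hn
  have hΛ0 : 0 ≤ Λ := zero_le_one.trans hΛ
  rw [abs_mul, abs_mul, abs_pow]
  have h1 : |β| ^ p ≤ Λ ^ p := pow_le_pow_left₀ (abs_nonneg β) hβ p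
  have h2 : L ^ d ≤ Λ ^ d := pow_le_pow_left₀ hL0 hL d
  have h3 : Λ ^ (p + d) ≤ Λ ^ 2 := pow_le_pow_right₀ hΛ hpd
  have hLm : 0 ≤ L ^ m * Ψ := mul_nonneg (pow_nonneg hL0 m) hΨ
  calc |c| * |β| ^ p * |S| ≤ 1 * Λ ^ p * (L ^ (m + d) * Ψ) := by
        gcongr
    _ = Λ ^ p * L ^ d * (L ^ m * Ψ) := by rw [pow_add]; ring
    _ ≤ Λ ^ p * Λ ^ d * (L ^ m * Ψ) := by gcongr
    _ = Λ ^ (p + d) * (L ^ m * Ψ) := by rw [pow_add]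
    _ ≤ Λ ^ 2 * (L ^ m * Ψ) := mul_le_mul_of_nonneg_right h3 hLm

/-- **One monomial `ℓ⁺(k₁)^{m₁}ℓ⁺(k₂)^{m₂}` (`m₁, m₂ ≥ 1`) against the order-`(1,1)` remainder weight**
`Wt = ((2β+ℓ⁺₁+ℓ⁺₂)²/4 − (P2(k₁)+P2(k₂))/4)·R₀₀ + (2β+ℓ⁺₁+ℓ⁺₂)/2·(R₀₁+R₁₀) + R₁₁` (remainders evaluated at `αk₁k₂`):
if every monomial sum `Σ a(k₁)a₂(k₂)ℓ⁺ⁱℓ⁺ʲR(αk₁k₂)` (`R ∈ {R₀₀,R₀₁,R₁₀,R₁₁}`, `a₂ ∈ {a, a·P2}`, `i,j ≥ 1`) is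
`≤ logⁱ⁺ʲY·Ψ`, then the sum is `≤ 15Λ²·log^{m₁+m₂}Y·Ψ` (`|β| ≤ Λ`, `log Y ≤ Λ`, `1 ≤ Λ`, `Y ≥ 1`).
[cite: KowalskiMichelVanderKam2000, (23)–(28) — derivation (order-(1,1) remainder weight, one monomial)] -/
theorem abs_monomial_weight_le {a P2 : ℕ → ℝ} {R₀₀ R₀₁ R₁₀ R₁₁ : ℝ → ℝ} {Y α β Λ Ψ : ℝ} {m₁ m₂ : ℕ}
    (hm₁ : 1 ≤ m₁) (hm₂ : 1 ≤ m₂) (hY : 1 ≤ Y) (hΛ : 1 ≤ Λ) (hβ : |β| ≤ Λ) (hLY : Real.log Y ≤ Λ) (hΨ : 0 ≤ Ψ)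
    (hR : ∀ R : ℝ → ℝ, (R = R₀₀ ∨ R = R₀₁ ∨ R = R₁₀ ∨ R = R₁₁) →
      ∀ a₂ : ℕ → ℝ, (a₂ = a ∨ a₂ = fun k ↦ a k * P2 k) → ∀ i j : ℕ, 1 ≤ i → 1 ≤ j →
      |∑ k₁ ∈ Icc 1 ⌊Y⌋₊, ∑ k₂ ∈ Icc 1 ⌊Y⌋₊,
          a k₁ * a₂ k₂ * ellp Y k₁ ^ i * ellp Y k₂ ^ j * R (α * k₁ * k₂)| ≤ Real.log Y ^ (i + j) * Ψ) :
    |∑ k₁ ∈ Icc 1 ⌊Y⌋₊, ∑ k₂ ∈ Icc 1 ⌊Y⌋₊,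
        a k₁ * a k₂ * ellp Y k₁ ^ m₁ * ellp Y k₂ ^ m₂ *
          (((2 * β + ellp Y k₁ + ellp Y k₂) ^ 2 / 4 - (P2 k₁ + P2 k₂) / 4) * R₀₀ (α * k₁ * k₂) +
            (2 * β + ellp Y k₁ + ellp Y k₂) / 2 * (R₀₁ (α * k₁ * k₂) + R₁₀ (α * k₁ * k₂)) +
            R₁₁ (α * k₁ * k₂))| ≤
      15 * Λ ^ 2 * (Real.log Y ^ (m₁ + m₂) * Ψ) := by
  have hL0 : 0 ≤ Real.log Y := Real.log_nonneg hY
  set I := Icc 1 ⌊Y⌋₊ with hI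
  -- the fifteen monomial bounds
  have h00 := fun i j (hi : 1 ≤ i) (hj : 1 ≤ j) ↦ hR R₀₀ (Or.inl rfl) a (Or.inl rfl) i j hi hj
  have h00P := fun i j (hi : 1 ≤ i) (hj : 1 ≤ j) ↦ hR R₀₀ (Or.inl rfl) (fun k ↦ a k * P2 k) (Or.inr rfl) i j hi hj
  have h01 := fun i j (hi : 1 ≤ i) (hj : 1 ≤ j) ↦ hR R₀₁ (Or.inr (Or.inl rfl)) a (Or.inl rfl) i j hi hj
  have h10 := fun i j (hi : 1 ≤ i) (hj : 1 ≤ j) ↦ hR R₁₀ (Or.inr (Or.inr (Or.inl rfl))) a (Or.inl rfl) i j hi hj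
  have h11 := fun i j (hi : 1 ≤ i) (hj : 1 ≤ j) ↦ hR R₁₁ (Or.inr (Or.inr (Or.inr rfl))) a (Or.inl rfl) i j hi hj
  have g1 := coef_term_le (c := 1) (p := 2) (d := 0) (m := m₁ + m₂) hΛ hβ hL0 hLY hΨ (by ring) (by norm_num)
    (by norm_num) (h00 m₁ m₂ hm₁ hm₂)
  have g2 := coef_term_le (c := 1) (p := 1) (d := 1) (m := m₁ + m₂) hΛ hβ hL0 hLY hΨ (by ring) (by norm_num)
    (by norm_num) (h00 (m₁ + 1) m₂ (by omega) hm₂)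
  have g3 := coef_term_le (c := 1) (p := 1) (d := 1) (m := m₁ + m₂) hΛ hβ hL0 hLY hΨ (by ring) (by norm_num)
    (by norm_num) (h00 m₁ (m₂ + 1) hm₁ (by omega))
  have g4 := coef_term_le (c := 1 / 4) (p := 0) (d := 2) (m := m₁ + m₂) hΛ hβ hL0 hLY hΨ (by ring) (by norm_num)
    (by norm_num [abs_of_pos]) (h00 (m₁ + 2) m₂ (by omega) hm₂)
  have g5 := coef_term_le (c := 1 / 2) (p := 0) (d := 2) (m := m₁ + m₂) hΛ hβ hL0 hLY hΨ (by ring) (by norm_num)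
    (by norm_num [abs_of_pos]) (h00 (m₁ + 1) (m₂ + 1) (by omega) (by omega))
  have g6 := coef_term_le (c := 1 / 4) (p := 0) (d := 2) (m := m₁ + m₂) hΛ hβ hL0 hLY hΨ (by ring) (by norm_num)
    (by norm_num [abs_of_pos]) (h00 m₁ (m₂ + 2) hm₁ (by omega))
  have g7 := coef_term_le (c := 1 / 4) (p := 0) (d := 0) (m := m₁ + m₂) hΛ hβ hL0 hLY hΨ (by ring) (by norm_num)
    (by norm_num [abs_of_pos]) (h00P m₁ m₂ hm₁ hm₂)
  have g8 := coef_term_le (c := 1 / 4) (p := 0) (d := 0) (m := m₁ + m₂) hΛ hβ hL0 hLY hΨ (by ring) (by norm_num)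
    (by norm_num [abs_of_pos]) (h00P m₂ m₁ hm₂ hm₁)
  have g9 := coef_term_le (c := 1) (p := 1) (d := 0) (m := m₁ + m₂) hΛ hβ hL0 hLY hΨ (by ring) (by norm_num)
    (by norm_num) (h01 m₁ m₂ hm₁ hm₂)
  have g10 := coef_term_le (c := 1 / 2) (p := 0) (d := 1) (m := m₁ + m₂) hΛ hβ hL0 hLY hΨ (by ring) (by norm_num)
    (by norm_num [abs_of_pos]) (h01 (m₁ + 1) m₂ (by omega) hm₂)
  have g11 := coef_term_le (c := 1 / 2) (p := 0) (d := 1) (m := m₁ + m₂) hΛ hβ hL0 hLY hΨ (by ring) (by norm_num)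
    (by norm_num [abs_of_pos]) (h01 m₁ (m₂ + 1) hm₁ (by omega))
  have g12 := coef_term_le (c := 1) (p := 1) (d := 0) (m := m₁ + m₂) hΛ hβ hL0 hLY hΨ (by ring) (by norm_num)
    (by norm_num) (h10 m₁ m₂ hm₁ hm₂)
  have g13 := coef_term_le (c := 1 / 2) (p := 0) (d := 1) (m := m₁ + m₂) hΛ hβ hL0 hLY hΨ (by ring) (by norm_num)
    (by norm_num [abs_of_pos]) (h10 (m₁ + 1) m₂ (by omega) hm₂)
  have g14 := coef_term_le (c := 1 / 2) (p := 0) (d := 1) (m := m₁ + m₂) hΛ hβ hL0 hLY hΨ (by ring) (by norm_num)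
    (by norm_num [abs_of_pos]) (h10 m₁ (m₂ + 1) hm₁ (by omega))
  have g15 := coef_term_le (c := 1) (p := 0) (d := 0) (m := m₁ + m₂) hΛ hβ hL0 hLY hΨ (by ring) (by norm_num)
    (by norm_num) (h11 m₁ m₂ hm₁ hm₂)
  -- the swap for the `P2(k₁)` piece
  have hswap : ∑ k₁ ∈ I, ∑ k₂ ∈ I, a k₁ * P2 k₁ * a k₂ * ellp Y k₁ ^ m₁ * ellp Y k₂ ^ m₂ * R₀₀ (α * k₁ * k₂) =
      ∑ k₁ ∈ I, ∑ k₂ ∈ I, a k₁ * (a k₂ * P2 k₂) * ellp Y k₁ ^ m₂ * ellp Y k₂ ^ m₁ * R₀₀ (α * k₁ * k₂) := by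
    rw [Finset.sum_comm]
    refine Finset.sum_congr rfl fun k₂ _ ↦ Finset.sum_congr rfl fun k₁ _ ↦ ?_
    rw [show α * (k₂ : ℝ) * k₁ = α * k₁ * k₂ by ring]
    ring
  -- the decomposition of the weight
  have hid : ∑ k₁ ∈ I, ∑ k₂ ∈ I,
      a k₁ * a k₂ * ellp Y k₁ ^ m₁ * ellp Y k₂ ^ m₂ *
        (((2 * β + ellp Y k₁ + ellp Y k₂) ^ 2 / 4 - (P2 k₁ + P2 k₂) / 4) * R₀₀ (α * k₁ * k₂) +
          (2 * β + ellp Y k₁ + ellp Y k₂) / 2 * (R₀₁ (α * k₁ * k₂) + R₁₀ (α * k₁ * k₂)) +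
          R₁₁ (α * k₁ * k₂)) =
      1 * β ^ 2 * ∑ k₁ ∈ I, ∑ k₂ ∈ I, a k₁ * a k₂ * ellp Y k₁ ^ m₁ * ellp Y k₂ ^ m₂ * R₀₀ (α * k₁ * k₂) +
      1 * β ^ 1 * ∑ k₁ ∈ I, ∑ k₂ ∈ I, a k₁ * a k₂ * ellp Y k₁ ^ (m₁ + 1) * ellp Y k₂ ^ m₂ * R₀₀ (α * k₁ * k₂) +
      1 * β ^ 1 * ∑ k₁ ∈ I, ∑ k₂ ∈ I, a k₁ * a k₂ * ellp Y k₁ ^ m₁ * ellp Y k₂ ^ (m₂ + 1) * R₀₀ (α * k₁ * k₂) +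
      1 / 4 * β ^ 0 * ∑ k₁ ∈ I, ∑ k₂ ∈ I, a k₁ * a k₂ * ellp Y k₁ ^ (m₁ + 2) * ellp Y k₂ ^ m₂ * R₀₀ (α * k₁ * k₂) +
      1 / 2 * β ^ 0 *
        ∑ k₁ ∈ I, ∑ k₂ ∈ I, a k₁ * a k₂ * ellp Y k₁ ^ (m₁ + 1) * ellp Y k₂ ^ (m₂ + 1) * R₀₀ (α * k₁ * k₂) +
      1 / 4 * β ^ 0 * ∑ k₁ ∈ I, ∑ k₂ ∈ I, a k₁ * a k₂ * ellp Y k₁ ^ m₁ * ellp Y k₂ ^ (m₂ + 2) * R₀₀ (α * k₁ * k₂) -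
      1 / 4 * β ^ 0 * ∑ k₁ ∈ I, ∑ k₂ ∈ I, a k₁ * (a k₂ * P2 k₂) * ellp Y k₁ ^ m₁ * ellp Y k₂ ^ m₂ * R₀₀ (α * k₁ * k₂) -
      1 / 4 * β ^ 0 * ∑ k₁ ∈ I, ∑ k₂ ∈ I, a k₁ * P2 k₁ * a k₂ * ellp Y k₁ ^ m₁ * ellp Y k₂ ^ m₂ * R₀₀ (α * k₁ * k₂) +
      1 * β ^ 1 * ∑ k₁ ∈ I, ∑ k₂ ∈ I, a k₁ * a k₂ * ellp Y k₁ ^ m₁ * ellp Y k₂ ^ m₂ * R₀₁ (α * k₁ * k₂) +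
      1 / 2 * β ^ 0 * ∑ k₁ ∈ I, ∑ k₂ ∈ I, a k₁ * a k₂ * ellp Y k₁ ^ (m₁ + 1) * ellp Y k₂ ^ m₂ * R₀₁ (α * k₁ * k₂) +
      1 / 2 * β ^ 0 * ∑ k₁ ∈ I, ∑ k₂ ∈ I, a k₁ * a k₂ * ellp Y k₁ ^ m₁ * ellp Y k₂ ^ (m₂ + 1) * R₀₁ (α * k₁ * k₂) +
      1 * β ^ 1 * ∑ k₁ ∈ I, ∑ k₂ ∈ I, a k₁ * a k₂ * ellp Y k₁ ^ m₁ * ellp Y k₂ ^ m₂ * R₁₀ (α * k₁ * k₂) +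
      1 / 2 * β ^ 0 * ∑ k₁ ∈ I, ∑ k₂ ∈ I, a k₁ * a k₂ * ellp Y k₁ ^ (m₁ + 1) * ellp Y k₂ ^ m₂ * R₁₀ (α * k₁ * k₂) +
      1 / 2 * β ^ 0 * ∑ k₁ ∈ I, ∑ k₂ ∈ I, a k₁ * a k₂ * ellp Y k₁ ^ m₁ * ellp Y k₂ ^ (m₂ + 1) * R₁₀ (α * k₁ * k₂) +
      1 * β ^ 0 * ∑ k₁ ∈ I, ∑ k₂ ∈ I, a k₁ * a k₂ * ellp Y k₁ ^ m₁ * ellp Y k₂ ^ m₂ * R₁₁ (α * k₁ * k₂) := by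
    simp only [Finset.mul_sum, ← Finset.sum_add_distrib, ← Finset.sum_sub_distrib]
    refine Finset.sum_congr rfl fun k₁ _ ↦ Finset.sum_congr rfl fun k₂ _ ↦ ?_
    ring
  rw [hid, hswap]
  have hΦ : 0 ≤ Λ ^ 2 * (Real.log Y ^ (m₁ + m₂) * Ψ) := by positivity
  rw [abs_le] at g1 g2 g3 g4 g5 g6 g7 g8 g9 g10 g11 g12 g13 g14 g15 ⊢
  constructor <;> linarith [g1.1, g1.2, g2.1, g2.2, g3.1, g3.2, g4.1, g4.2, g5.1, g5.2, g6.1, g6.2, g7.1, g7.2,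
    g8.1, g8.2, g9.1, g9.2, g10.1, g10.2, g11.1, g11.2, g12.1, g12.2, g13.1, g13.2, g14.1, g14.2, g15.1, g15.2]

/-- **The profile-weighted sum against the order-`(1,1)` remainder weight**: under the hypotheses of
`abs_monomial_weight_le`, for a real polynomial `P` with `P₀ = 0`, `0 < L`, `log Y ≤ L`:
`|Σ a(k₁)P(ℓ⁺₁/L)·a(k₂)P(ℓ⁺₂/L)·Wt(k₁,k₂)| ≤ 15(Σᵢ|Pᵢ|)²Λ²Ψ`.
[cite: KowalskiMichelVanderKam2000, (23)–(28) — derivation (order-(1,1) remainder weight, general profile)] -/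
theorem abs_profile_weight_le (P : ℝ[X]) (hP0 : P.coeff 0 = 0) {a P2 : ℕ → ℝ} {R₀₀ R₀₁ R₁₀ R₁₁ : ℝ → ℝ}
    {Y α β Λ Ψ L : ℝ} (hY : 1 ≤ Y) (hΛ : 1 ≤ Λ) (hβ : |β| ≤ Λ) (hLY : Real.log Y ≤ Λ) (hΨ : 0 ≤ Ψ)
    (hL : 0 < L) (hYL : Real.log Y ≤ L)
    (hR : ∀ R : ℝ → ℝ, (R = R₀₀ ∨ R = R₀₁ ∨ R = R₁₀ ∨ R = R₁₁) →
      ∀ a₂ : ℕ → ℝ, (a₂ = a ∨ a₂ = fun k ↦ a k * P2 k) → ∀ i j : ℕ, 1 ≤ i → 1 ≤ j →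
      |∑ k₁ ∈ Icc 1 ⌊Y⌋₊, ∑ k₂ ∈ Icc 1 ⌊Y⌋₊,
          a k₁ * a₂ k₂ * ellp Y k₁ ^ i * ellp Y k₂ ^ j * R (α * k₁ * k₂)| ≤ Real.log Y ^ (i + j) * Ψ) :
    |∑ k₁ ∈ Icc 1 ⌊Y⌋₊, ∑ k₂ ∈ Icc 1 ⌊Y⌋₊,
        a k₁ * P.eval (ellp Y k₁ / L) * (a k₂ * P.eval (ellp Y k₂ / L)) *
          (((2 * β + ellp Y k₁ + ellp Y k₂) ^ 2 / 4 - (P2 k₁ + P2 k₂) / 4) * R₀₀ (α * k₁ * k₂) +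
            (2 * β + ellp Y k₁ + ellp Y k₂) / 2 * (R₀₁ (α * k₁ * k₂) + R₁₀ (α * k₁ * k₂)) +
            R₁₁ (α * k₁ * k₂))| ≤
      15 * (∑ i ∈ Finset.range (P.natDegree + 1), |P.coeff i|) ^ 2 * Λ ^ 2 * Ψ := by
  have hL0 : 0 ≤ Real.log Y := Real.log_nonneg hY
  set Rg := Finset.range (P.natDegree + 1) with hRg
  set SP : ℝ := ∑ i ∈ Rg, |P.coeff i| with hSP
  have hratio : Real.log Y / L ≤ 1 := (div_le_one hL).2 hYL
  have hratio0 : 0 ≤ Real.log Y / L := div_nonneg hL0 hL.le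
  rw [profile_expand P L Y a a (fun k₁ k₂ ↦
      ((2 * β + ellp Y k₁ + ellp Y k₂) ^ 2 / 4 - (P2 k₁ + P2 k₂) / 4) * R₀₀ (α * k₁ * k₂) +
        (2 * β + ellp Y k₁ + ellp Y k₂) / 2 * (R₀₁ (α * k₁ * k₂) + R₁₀ (α * k₁ * k₂)) + R₁₁ (α * k₁ * k₂))
    (Icc 1 ⌊Y⌋₊)]
  set G : ℝ := 15 * Λ ^ 2 * Ψ with hG
  have hG0 : 0 ≤ G := by positivity
  have hterm : ∀ i ∈ Rg, ∀ j ∈ Rg, |P.coeff i / L ^ i * (P.coeff j / L ^ j) *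
      ∑ k₁ ∈ Icc 1 ⌊Y⌋₊, ∑ k₂ ∈ Icc 1 ⌊Y⌋₊, a k₁ * a k₂ * ellp Y k₁ ^ i * ellp Y k₂ ^ j *
        (((2 * β + ellp Y k₁ + ellp Y k₂) ^ 2 / 4 - (P2 k₁ + P2 k₂) / 4) * R₀₀ (α * k₁ * k₂) +
          (2 * β + ellp Y k₁ + ellp Y k₂) / 2 * (R₀₁ (α * k₁ * k₂) + R₁₀ (α * k₁ * k₂)) + R₁₁ (α * k₁ * k₂))| ≤
      |P.coeff i| * |P.coeff j| * G := by
    intro i _ j _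
    rcases Nat.eq_zero_or_pos i with rfl | hi
    · rw [hP0]; simp
    rcases Nat.eq_zero_or_pos j with rfl | hj
    · rw [hP0]; simp
    rw [abs_mul, abs_mul, abs_div, abs_div, abs_of_pos (pow_pos hL i), abs_of_pos (pow_pos hL j)]
    have h := abs_monomial_weight_le (m₁ := i) (m₂ := j) hi hj hY hΛ hβ hLY hΨ hR
    have hpow : Real.log Y ^ (i + j) / (L ^ i * L ^ j) ≤ 1 := by
      rw [← pow_add, ← div_pow]
      exact pow_le_one₀ hratio0 hratio
    calc |P.coeff i| / L ^ i * (|P.coeff j| / L ^ j) *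
          |∑ k₁ ∈ Icc 1 ⌊Y⌋₊, ∑ k₂ ∈ Icc 1 ⌊Y⌋₊, a k₁ * a k₂ * ellp Y k₁ ^ i * ellp Y k₂ ^ j *
            (((2 * β + ellp Y k₁ + ellp Y k₂) ^ 2 / 4 - (P2 k₁ + P2 k₂) / 4) * R₀₀ (α * k₁ * k₂) +
              (2 * β + ellp Y k₁ + ellp Y k₂) / 2 * (R₀₁ (α * k₁ * k₂) + R₁₀ (α * k₁ * k₂)) +
              R₁₁ (α * k₁ * k₂))|
        ≤ |P.coeff i| / L ^ i * (|P.coeff j| / L ^ j) * (15 * Λ ^ 2 * (Real.log Y ^ (i + j) * Ψ)) :=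
          mul_le_mul_of_nonneg_left h (by positivity)
      _ = |P.coeff i| * |P.coeff j| * G * (Real.log Y ^ (i + j) / (L ^ i * L ^ j)) := by
          rw [hG]; field_simp
      _ ≤ |P.coeff i| * |P.coeff j| * G * 1 := by gcongr
      _ = _ := mul_one _
  calc _ ≤ ∑ i ∈ Rg, ∑ j ∈ Rg, |P.coeff i| * |P.coeff j| * G := by
        refine (Finset.abs_sum_le_sum_abs _ _).trans (Finset.sum_le_sum fun i hi ↦ ?_)
        exact (Finset.abs_sum_le_sum_abs _ _).trans (Finset.sum_le_sum fun j hj ↦ hterm i hi j hj)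
    _ = SP * SP * G := by
        rw [hSP, Finset.sum_mul_sum, Finset.sum_mul]
        refine Finset.sum_congr rfl fun i _ ↦ ?_
        rw [Finset.sum_mul]
    _ = 15 * SP ^ 2 * Λ ^ 2 * Ψ := by rw [hG]; ring

end Summit.Parity.GeneralizedHardyLittlewood.Theorems.MomentsBeyondDiagonal.DiagCorner

end
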